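import Literature.Analysis.FluidPDE.NSFourierData
import Literature.Analysis.FluidPDE.NSFourierSobolev
import Literature.Analysis.FluidPDE.RapidDecayLemmas
import Literature.Analysis.FluidPDE.TaoForcedUniquenessSchwartzForce
import HarnessLib

/-!
# The Fourier-side force of a Schwartz-on-slab forcing term (physical transfer for the forced
# Fourier–Picard construction of Tao 2013, Thm. 5.4 WITH force)

Analysis/FluidPDE proof file (cell `pub/ns-blowup`, seat `ns-blowup-lit` g10; «PHYSICAL TRANSFER OF
THE FORCE» for the forced twin of the tree's Fourier-side local existence engine
`NSFourier*` / `FourierL2Picard*` / `TaoH1Fourier*`, whose existence half is seat lean2's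
`ForcedFourierDuhamelForcing` …; bears_on the Literature leaf
`tao2011_forced_H1_local_almost_regular` / `tao2011_smooth_local_existence_forced` under the E–C
route; WHAT THIS IS NOT: not a statement about Navier–Stokes — Fourier bookkeeping of a forcing
term). ONE definition (`FourierNS.forceData`, a plumbing `def` with a body, no `Prop`) and theorems;
no named facts.

The tree's `NSFourierData.lean` converts a Clay DATUM `u₀` (smooth, `HasRapidSpatialDecay`,
divergence free) into the Fourier datum `a = 𝓕⁻u₀^ℂ` of the Picard iteration (continuous, every
polynomial decay, `𝓕 a = u₀`, conjugation symmetric). This file does the same, slice by slice and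
UNIFORMLY IN TIME, for a FORCE `f : ℝ → ℝ^ι → ℝ^ι` which is Schwartz on the closed slab
`[0, T] × ℝ^ι` in the tree's sense — jointly smooth there (`IsSmoothSpaceTimeOn (Icc 0 T) f`) with
the uniform decay `(1 + ‖x‖)^K ‖Dⁿ(uncurry f)(t, x)‖ ≤ C_{n,K}` (`HasUniformRapidDecayOn (Icc 0 T) f`);
Tao's "`(u₀, f, T)` Schwartz" (Def. 1.1), and every Clay force (Fefferman (5)) restricted to a slab
(`IsSmoothOnHalfSpace.isSmoothSpaceTimeOn_Icc`, `HasRapidSpaceTimeDecay.hasUniformRapidDecayOn`):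

* §1 slices of a slab-Schwartz force: the all-orders slice bound
  `‖Dᵐ(f t)(x)‖ ≤ ‖Dᵐ(uncurry f)|_{[0,T] × ℝ^ι}(t, x)‖` (`IsSmoothSpaceTimeOn.norm_iteratedFDeriv_slice_le_Icc`,
  the slab twin of `IsSmoothOnHalfSpace.norm_iteratedFDeriv_slice_le`), hence every slice is
  Schwartz (`HasUniformRapidDecayOn.hasRapidSpatialDecay_slice`) with Schwartz constants UNIFORM
  in `t ∈ [0, T]` (`HasUniformRapidDecayOn.exists_uniform_slice_bound`);
* §2 the Fourier-side force `b = forceData`: `b t ξ l = 𝓕⁻((f (clamp T t))ₗ^ℂ)(ξ)` (time clamped to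
  `[0, T]` as everywhere in the Picard files), with, for every `t`: continuity in `ξ`, inversion
  `𝓕 (b t ·)ₗ = (f (clamp T t))ₗ^ℂ`, synthesis `synthVel (b t) = f (clamp T t)`, conjugation symmetry —
  all by the datum file applied to the slice;
* §3 **uniform decay**: for every `K` one constant `B` with `HasDecay K B (b t)` for ALL `t` (the
  Schwartz seminorms of `𝓕⁻g` are bounded by finitely many Schwartz seminorms of `g` —
  `Seminorm.bound_of_continuous` for the continuous inverse transform of the Schwartz space — and
  those of the slices are uniform by §1);
* §4 **joint continuity** of `(t, ξ) ↦ b t ξ` and continuity in `t` at fixed `ξ` (dominated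
  convergence under the Fourier integral, dominating function `C (1 + ‖x‖)^{-(d+1)}`).

The time-derivative dictionary (`∂ₜb = 𝓕⁻(∂ₜf)^ℂ`, needed only by the classical half of the
engine) is not in this file.

## References

* T. Tao, *Localisation and compactness properties of the Navier–Stokes global regularity
  problem*, Anal. PDE 6 (2013) = arXiv:1108.1165, Def. 1.1 (p. 3: Schwartz data `(u₀, f, T)`),
  §5 proof of Thm. 5.4 (arXiv Thm. 31, p. 18: the Duhamel/Picard scheme with the forcing term).
  [`Tao2011`]
* E. M. Stein, G. Weiss, *Introduction to Fourier Analysis on Euclidean Spaces*, PUP 1971, Ch. I,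
  Thm. 1.8 / Thm. 2.3 (transform of Schwartz functions, inversion). [`SteinWeiss1971`]
* C. Fefferman, Clay problem description, (5). [`FeffermanClay2006`]
-/

noncomputable section

open MeasureTheory Real Set Filter Function Complex FourierTransform
open scoped FourierTransform RealInnerProductSpace ContDiff SchwartzMap ComplexConjugate Pointwise NNReal
open _root_.Topology

namespace Literature.Analysis.FluidPDE

/-! ## §1 Slices of a Schwartz-on-slab force -/

section SliceIcc

variable {X : Type*} [NormedAddCommGroup X] [InnerProductSpace ℝ X]
  {F : Type*} [NormedAddCommGroup F] [NormedSpace ℝ F]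
  {T : ℝ} {f : ℝ → X → F}

/-- **Slice derivatives of all orders are bounded by the joint within-derivatives on the slab.**
For `f` jointly smooth on `[0, T] × X` (`T > 0`), `t ∈ [0, T]` and every order `m`,
`‖Dᵐ(f t)(x)‖ ≤ ‖Dᵐ_{(t,x)}(uncurry f)|_{[0,T] × X}(t, x)‖` (chain rule with the affine embedding
`y ↦ (t, y)`, whose linear part `inr` has norm `≤ 1`; the slab twin of
`IsSmoothOnHalfSpace.norm_iteratedFDeriv_slice_le`). [cite: Tao2011, Def. 1.1 (p. 3)] -/
theorem IsSmoothSpaceTimeOn.norm_iteratedFDeriv_slice_le_Icc (hf : IsSmoothSpaceTimeOn (Icc 0 T) f)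
    (hT : 0 < T) (m : ℕ) {t : ℝ} (ht : t ∈ Icc 0 T) (x : X) :
    ‖iteratedFDeriv ℝ m (f t) x‖ ≤
      ‖iteratedFDerivWithin ℝ m (uncurry f) (Icc (0 : ℝ) T ×ˢ univ) (t, x)‖ := by
  set s : Set (ℝ × X) := Icc (0 : ℝ) T ×ˢ univ with hs
  set a : ℝ × X := (t, 0) with ha
  set s' : Set (ℝ × X) := Icc (-t) (T - t) ×ˢ univ with hs'
  set G : ℝ × X → F := fun z => uncurry f (a + z) with hG
  have has : a +ᵥ s' = s := by
    ext z
    rw [Set.mem_vadd_set]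
    constructor
    · rintro ⟨w, hw, rfl⟩
      simp only [hs', hs, mem_prod, mem_Icc, mem_univ, and_true] at hw ⊢
      simp only [ha, vadd_eq_add, Prod.fst_add]
      constructor <;> linarith [hw.1, hw.2]
    · intro hz
      refine ⟨z - a, ?_, by simp⟩
      simp only [hs', hs, mem_prod, mem_Icc, mem_univ, and_true] at hz ⊢
      simp only [ha, Prod.fst_sub]
      constructor <;> linarith [hz.1, hz.2]
  have hmaps : MapsTo (fun z : ℝ × X => a + z) s' s := by
    intro z hz
    rw [← has]
    exact ⟨z, hz, rfl⟩
  have hGs : ContDiffOn ℝ ∞ G s' :=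
    hf.comp (contDiff_const.add contDiff_id).contDiffOn hmaps
  have hUs' : UniqueDiffOn ℝ s' := (uniqueDiffOn_Icc (by linarith)).prod uniqueDiffOn_univ
  set L : X →L[ℝ] ℝ × X := ContinuousLinearMap.inr ℝ ℝ X with hL
  have hmem : ∀ y : X, L y ∈ s' := fun y => by
    simp only [hL, ContinuousLinearMap.inr_apply, hs', mem_prod, mem_Icc, mem_univ, and_true]
    constructor <;> linarith [ht.1, ht.2]
  have hpre : L ⁻¹' s' = univ := Set.eq_univ_of_forall fun y => hmem y
  have key := ContinuousLinearMap.iteratedFDerivWithin_comp_right (𝕜 := ℝ) L hGs hUs'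
    (by rw [hpre]; exact uniqueDiffOn_univ) (hmem x) (i := m) (by exact_mod_cast le_top)
  have hslice : f t = G ∘ L := by
    funext y
    simp [hG, hL, ha, uncurry]
  have hGF : iteratedFDerivWithin ℝ m G s' (L x) = iteratedFDerivWithin ℝ m (uncurry f) s (t, x) := by
    rw [hG, iteratedFDerivWithin_comp_add_left, has]
    congr 1
    simp [hL, ha]
  calc ‖iteratedFDeriv ℝ m (f t) x‖
      = ‖iteratedFDerivWithin ℝ m (G ∘ L) (L ⁻¹' s') x‖ := by
        rw [hpre, iteratedFDerivWithin_univ, hslice]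
    _ = ‖(iteratedFDerivWithin ℝ m G s' (L x)).compContinuousLinearMap fun _ => L‖ := by rw [key]
    _ ≤ ‖iteratedFDerivWithin ℝ m G s' (L x)‖ * ∏ _i : Fin m, ‖L‖ :=
        ContinuousMultilinearMap.norm_compContinuousLinearMap_le _ _
    _ ≤ ‖iteratedFDerivWithin ℝ m G s' (L x)‖ :=
        mul_le_of_le_one_right (norm_nonneg _)
          (Finset.prod_le_one (fun _ _ => ContinuousLinearMap.opNorm_nonneg L)
            fun _ _ => ContinuousLinearMap.norm_inr_le_one ℝ ℝ X)
    _ = _ := by rw [hGF]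

/-- **Uniform Schwartz bounds for the slices**: for `f` Schwartz on the slab `[0, T] × X`
(`T > 0`) and all `n, K` there is ONE constant `C` with `(1 + ‖x‖)^K ‖Dⁿ(f t)(x)‖ ≤ C` for every
`t ∈ [0, T]` and every `x`. [cite: Tao2011, Def. 1.1 (p. 3)] -/
theorem HasUniformRapidDecayOn.exists_uniform_slice_bound
    (hd : HasUniformRapidDecayOn (Icc 0 T) f) (hf : IsSmoothSpaceTimeOn (Icc 0 T) f) (hT : 0 < T)
    (n K : ℕ) :
    ∃ C : ℝ, 0 ≤ C ∧ ∀ t ∈ Icc 0 T, ∀ x : X, (1 + ‖x‖) ^ K * ‖iteratedFDeriv ℝ n (f t) x‖ ≤ C := by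
  obtain ⟨C, hC⟩ := hd n K
  refine ⟨max C 0, le_max_right _ _, fun t ht x => ?_⟩
  calc (1 + ‖x‖) ^ K * ‖iteratedFDeriv ℝ n (f t) x‖
      ≤ (1 + ‖x‖) ^ K * ‖iteratedFDerivWithin ℝ n (uncurry f) (Icc (0 : ℝ) T ×ˢ univ) (t, x)‖ :=
        mul_le_mul_of_nonneg_left (hf.norm_iteratedFDeriv_slice_le_Icc hT n ht x) (by positivity)
    _ ≤ C := hC t ht x
    _ ≤ max C 0 := le_max_left _ _

/-- **Every slice of a Schwartz-on-slab force is Schwartz** (`HasRapidSpatialDecay (f t)` for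
`t ∈ [0, T]`). [cite: Tao2011, Def. 1.1 (p. 3)] -/
theorem HasUniformRapidDecayOn.hasRapidSpatialDecay_slice
    (hd : HasUniformRapidDecayOn (Icc 0 T) f) (hf : IsSmoothSpaceTimeOn (Icc 0 T) f) (hT : 0 < T)
    {t : ℝ} (ht : t ∈ Icc 0 T) : HasRapidSpatialDecay (f t) := by
  intro n K
  obtain ⟨C, -, hC⟩ := hd.exists_uniform_slice_bound hf hT n K
  exact ⟨C, fun x => hC t ht x⟩

end SliceIcc

/-! ## §2 The Fourier-side force -/

namespace FourierNS

section ForceData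

variable {ι : Type*} [Fintype ι] [DecidableEq ι]
variable {T : ℝ} {f : ℝ → EuclideanSpace ℝ ι → EuclideanSpace ℝ ι}

omit [DecidableEq ι] in
/-- The slices `f (clamp T t)` are smooth. [cite: Tao2011, Def. 1.1 (p. 3)] -/
theorem contDiff_slice_clamp (hT : 0 < T) (hf : IsSmoothSpaceTimeOn (Icc 0 T) f) (t : ℝ) :
    ContDiff ℝ ∞ (f (clamp T t)) :=
  hf.contDiff_slice (clamp_mem_Icc hT.le t)

omit [DecidableEq ι] in
/-- The slices `f (clamp T t)` are Schwartz. [cite: Tao2011, Def. 1.1 (p. 3)] -/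
theorem hasRapidSpatialDecay_slice_clamp (hT : 0 < T) (hf : IsSmoothSpaceTimeOn (Icc 0 T) f)
    (hd : HasUniformRapidDecayOn (Icc 0 T) f) (t : ℝ) : HasRapidSpatialDecay (f (clamp T t)) :=
  hd.hasRapidSpatialDecay_slice hf hT (clamp_mem_Icc hT.le t)

omit [DecidableEq ι] in
/-- **The Fourier-side force** of a Schwartz-on-slab forcing term:
`forceData hT hf hd t ξ l = 𝓕⁻ (f (clamp T t))ₗ^ℂ (ξ)` — the Fourier datum (`fourierData`, inverse
transform of the complexified components) of the slice at the clamped time `clamp T t ∈ [0, T]`,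
so that the synthesis `Re 𝓕` returns the slice (the forcing term of the Fourier-side Duhamel
formula in the proof of Tao 2013, Thm. 5.4). [cite: Tao2011, Thm. 5.4 proof (arXiv Thm. 31, p. 18)] -/
def forceData (hT : 0 < T) (hf : IsSmoothSpaceTimeOn (Icc 0 T) f)
    (hd : HasUniformRapidDecayOn (Icc 0 T) f) (t : ℝ) : EuclideanSpace ℝ ι → ι → ℂ :=
  fourierData (contDiff_slice_clamp hT hf t) (hasRapidSpatialDecay_slice_clamp hT hf hd t)

variable (hT : 0 < T) (hf : IsSmoothSpaceTimeOn (Icc 0 T) f) (hd : HasUniformRapidDecayOn (Icc 0 T) f)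

omit [DecidableEq ι] in
/-- The components of the Fourier-side force as inverse Fourier integrals of the complexified
components of the clamped slice. [cite: Tao2011, Thm. 5.4 proof (arXiv Thm. 31, p. 18)] -/
theorem forceData_eq_fourierInv (t : ℝ) (l : ι) :
    (fun ξ => forceData hT hf hd t ξ l) = 𝓕⁻ (fun x => ((f (clamp T t) x l : ℝ) : ℂ)) :=
  fourierData_eq_fourierInv _ _ l

omit [DecidableEq ι] in
/-- Pointwise form of `forceData_eq_fourierInv`. [cite: Tao2011, Thm. 5.4 proof (arXiv Thm. 31, p. 18)] -/
theorem forceData_apply (t : ℝ) (ξ : EuclideanSpace ℝ ι) (l : ι) :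
    forceData hT hf hd t ξ l = 𝓕⁻ (fun x => ((f (clamp T t) x l : ℝ) : ℂ)) ξ :=
  congrFun (forceData_eq_fourierInv hT hf hd t l) ξ

omit [DecidableEq ι] in
/-- On `[0, T]` the clamp disappears: `forceData t ξ l = 𝓕⁻ (f t)ₗ^ℂ (ξ)`. [cite: Tao2011, Thm. 5.4 proof (arXiv Thm. 31, p. 18)] -/
theorem forceData_apply_of_mem {t : ℝ} (ht : t ∈ Icc 0 T) (ξ : EuclideanSpace ℝ ι) (l : ι) :
    forceData hT hf hd t ξ l = 𝓕⁻ (fun x => ((f t x l : ℝ) : ℂ)) ξ := by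
  rw [forceData_apply, clamp_of_mem ht]

omit [DecidableEq ι] in
/-- **Continuity in the frequency** of each slice of the Fourier-side force. [cite: Tao2011, Thm. 5.4 proof (arXiv Thm. 31, p. 18)] -/
theorem continuous_forceData_slice (t : ℝ) : Continuous (forceData hT hf hd t) :=
  continuous_fourierData _ _

omit [DecidableEq ι] in
/-- **Fourier inversion for the force**: `𝓕 (b t ·)ₗ = (f (clamp T t))ₗ^ℂ`. [cite: SteinWeiss1971, Ch. I Thm. 2.3 + Thm. 1.8] -/
theorem fourier_forceData (t : ℝ) (l : ι) :
    𝓕 (fun ξ => forceData hT hf hd t ξ l) = fun x => ((f (clamp T t) x l : ℝ) : ℂ) :=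
  fourier_fourierData _ _ l

omit [DecidableEq ι] in
/-- **The synthesis of the Fourier-side force is the force**: `synthVel (b t) = f (clamp T t)`,
in particular `= f t` on `[0, T]`. [cite: SteinWeiss1971, Ch. I Thm. 2.3 + Thm. 1.8] -/
theorem synthVel_forceData (t : ℝ) : synthVel (forceData hT hf hd t) = f (clamp T t) := by
  funext x
  ext l
  rw [synthVel_apply, congrFun (fourier_forceData hT hf hd t l) x, Complex.ofReal_re]

omit [DecidableEq ι] in
/-- `synthVel (b t) = f t` for `t ∈ [0, T]`. [cite: SteinWeiss1971, Ch. I Thm. 2.3 + Thm. 1.8] -/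
theorem synthVel_forceData_of_mem {t : ℝ} (ht : t ∈ Icc 0 T) :
    synthVel (forceData hT hf hd t) = f t := by
  rw [synthVel_forceData, clamp_of_mem ht]

omit [DecidableEq ι] in
/-- **Conjugation symmetry** of the Fourier-side force (the force is real):
`b t (-ξ) l = conj (b t ξ l)`. [cite: Tao2011, Thm. 5.4 proof (arXiv Thm. 31, p. 18)] -/
theorem forceData_conj_symm (t : ℝ) (ξ : EuclideanSpace ℝ ι) (l : ι) :
    forceData hT hf hd t (-ξ) l = conj (forceData hT hf hd t ξ l) :=
  fourierData_conj_symm _ _ ξ l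

end ForceData

/-! ## §3 Uniform decay of the Fourier-side force -/

section UniformDecay

variable {ι : Type*} [Fintype ι] [DecidableEq ι]
variable {T : ℝ} {f : ℝ → EuclideanSpace ℝ ι → EuclideanSpace ℝ ι}
variable (hT : 0 < T) (hf : IsSmoothSpaceTimeOn (Icc 0 T) f) (hd : HasUniformRapidDecayOn (Icc 0 T) f)

omit [DecidableEq ι] in
/-- **Uniform Schwartz seminorms of the complexified slices**: for all `k, n` one constant bounds
`p_{k,n}((f (clamp T t))ₗ^ℂ)` for every `t` and every component `l`. [cite: Tao2011, Def. 1.1 (p. 3)] -/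
theorem seminorm_schwartzData_slice_le (k n : ℕ) :
    ∃ M : ℝ, 0 ≤ M ∧ ∀ (t : ℝ) (l : ι),
      SchwartzMap.seminorm ℝ k n
        (schwartzData (contDiff_slice_clamp hT hf t) (hasRapidSpatialDecay_slice_clamp hT hf hd t) l)
          ≤ M := by
  obtain ⟨C, hC0, hC⟩ := hd.exists_uniform_slice_bound hf hT n k
  refine ⟨C, hC0, fun t l => ?_⟩
  refine SchwartzMap.seminorm_le_bound ℝ k n _ hC0 fun x => ?_
  have hsm : ContDiff ℝ ∞ (f (clamp T t)) := contDiff_slice_clamp hT hf t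
  change ‖x‖ ^ k * ‖iteratedFDeriv ℝ n (cplxCLM l ∘ f (clamp T t)) x‖ ≤ C
  have h1 : ‖iteratedFDeriv ℝ n (cplxCLM l ∘ f (clamp T t)) x‖ ≤
      ‖cplxCLM (ι := ι) l‖ * ‖iteratedFDeriv ℝ n (f (clamp T t)) x‖ :=
    (cplxCLM l).norm_iteratedFDeriv_comp_left hsm.contDiffAt (mod_cast le_top)
  have h2 : ‖cplxCLM (ι := ι) l‖ ≤ 1 := by
    refine ContinuousLinearMap.opNorm_le_bound _ zero_le_one fun y => ?_
    rw [cplxCLM_apply, Complex.norm_real, one_mul]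
    exact PiLp.norm_apply_le y l
  have h3 : ‖x‖ ^ k ≤ (1 + ‖x‖) ^ k :=
    pow_le_pow_left₀ (norm_nonneg _) (le_add_of_nonneg_left zero_le_one) k
  calc ‖x‖ ^ k * ‖iteratedFDeriv ℝ n (cplxCLM l ∘ f (clamp T t)) x‖
      ≤ (1 + ‖x‖) ^ k * (1 * ‖iteratedFDeriv ℝ n (f (clamp T t)) x‖) :=
        mul_le_mul h3 (h1.trans (mul_le_mul_of_nonneg_right h2 (norm_nonneg _))) (norm_nonneg _)
          (by positivity)
    _ = (1 + ‖x‖) ^ k * ‖iteratedFDeriv ℝ n (f (clamp T t)) x‖ := by rw [one_mul]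
    _ ≤ C := hC _ (clamp_mem_Icc hT.le t) x

omit [DecidableEq ι] in
/-- **Each Schwartz seminorm of `𝓕⁻g` is bounded by finitely many Schwartz seminorms of `g`**
(continuity of the inverse Fourier transform on the Schwartz space, Mathlib
`SchwartzMap.instContinuousFourierInv`, through `Seminorm.bound_of_continuous`).
[cite: SteinWeiss1971, Ch. I Thm. 2.3 + Thm. 1.8] -/
theorem exists_seminorm_fourierInv_le (k n : ℕ) :
    ∃ (s : Finset (ℕ × ℕ)) (C : ℝ), 0 ≤ C ∧ ∀ g : 𝓢(EuclideanSpace ℝ ι, ℂ),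
      SchwartzMap.seminorm ℝ k n (𝓕⁻ g : 𝓢(EuclideanSpace ℝ ι, ℂ)) ≤
        C * (s.sup (schwartzSeminormFamily ℝ (EuclideanSpace ℝ ι) ℂ)) g := by
  set L : 𝓢(EuclideanSpace ℝ ι, ℂ) →L[ℝ] 𝓢(EuclideanSpace ℝ ι, ℂ) :=
    FourierTransform.fourierInvCLM ℝ 𝓢(EuclideanSpace ℝ ι, ℂ) with hL
  set q : Seminorm ℝ 𝓢(EuclideanSpace ℝ ι, ℂ) :=
    (SchwartzMap.seminorm ℝ k n).comp L.toLinearMap with hq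
  have hqc : Continuous q := by
    have h1 : Continuous (SchwartzMap.seminorm ℝ (E := EuclideanSpace ℝ ι) (F := ℂ) k n) :=
      (schwartz_withSeminorms ℝ (EuclideanSpace ℝ ι) ℂ).continuous_seminorm (k, n)
    exact h1.comp L.continuous
  obtain ⟨s, C, -, hle⟩ :=
    Seminorm.bound_of_continuous (schwartz_withSeminorms ℝ (EuclideanSpace ℝ ι) ℂ) q hqc
  refine ⟨s, C, C.coe_nonneg, fun g => ?_⟩
  have := hle g
  rw [hq, Seminorm.comp_apply, _root_.smul_apply, NNReal.smul_def, smul_eq_mul] at this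
  simpa [hL] using this

omit [DecidableEq ι] in
/-- **Uniform polynomial decay of the Fourier-side force**: for every `K` there is one `B ≥ 0`
with `‖b t ξ‖ ≤ B (1 + ‖ξ‖)^{-K}` for ALL `t` and `ξ` (`HasDecay K B (forceData t)`), the Fourier
image of "`(1 + ‖x‖)^K ‖Dⁿf(t,x)‖ ≤ C_{n,K}` uniformly on the slab".
[cite: Tao2011, Def. 1.1 (p. 3) and Thm. 5.4 proof (arXiv Thm. 31, p. 18)] -/
theorem hasDecay_forceData_uniform (K : ℕ) :
    ∃ B : ℝ, 0 ≤ B ∧ ∀ t : ℝ, HasDecay K B (forceData hT hf hd t) := by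
  classical
  -- for each index `m ≤ (K, 0)`: a finite set of input seminorms and a constant
  have hstep : ∀ m : ℕ × ℕ, ∃ D : ℝ, 0 ≤ D ∧ ∀ (t : ℝ) (l : ι),
      SchwartzMap.seminorm ℝ m.1 m.2
        (𝓕⁻ (schwartzData (contDiff_slice_clamp hT hf t)
          (hasRapidSpatialDecay_slice_clamp hT hf hd t) l) : 𝓢(EuclideanSpace ℝ ι, ℂ)) ≤ D := by
    intro m
    obtain ⟨s, C, hC0, hC⟩ := exists_seminorm_fourierInv_le (ι := ι) m.1 m.2
    have hM : ∀ i : ℕ × ℕ, ∃ M : ℝ, 0 ≤ M ∧ ∀ (t : ℝ) (l : ι),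
        SchwartzMap.seminorm ℝ i.1 i.2
          (schwartzData (contDiff_slice_clamp hT hf t)
            (hasRapidSpatialDecay_slice_clamp hT hf hd t) l) ≤ M :=
      fun i => seminorm_schwartzData_slice_le hT hf hd i.1 i.2
    choose M hM0 hM using hM
    refine ⟨C * ∑ i ∈ s, M i, mul_nonneg hC0 (Finset.sum_nonneg fun i _ => hM0 i),
      fun t l => ?_⟩
    refine (hC _).trans (mul_le_mul_of_nonneg_left ?_ hC0)
    refine Seminorm.finset_sup_apply_le (Finset.sum_nonneg fun i _ => hM0 i) fun i hi => ?_
    exact (hM i t l).trans (Finset.single_le_sum (fun j _ => hM0 j) hi)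
  choose D hD0 hD using hstep
  set D₀ : ℝ := ∑ m ∈ Finset.Iic (K, 0), D m with hD₀
  have hD₀0 : 0 ≤ D₀ := Finset.sum_nonneg fun m _ => hD0 m
  set A : ℝ := 2 ^ K * D₀ with hA
  have hA0 : 0 ≤ A := by positivity
  refine ⟨∑ _l : ι, A, Finset.sum_nonneg fun _ _ => hA0, fun t => ?_⟩
  have hcomp : ∀ l, HasDecay K A (fun ξ => forceData hT hf hd t ξ l) := by
    intro l ξ
    set g : 𝓢(EuclideanSpace ℝ ι, ℂ) := 𝓕⁻ (schwartzData (contDiff_slice_clamp hT hf t)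
      (hasRapidSpatialDecay_slice_clamp hT hf hd t) l) with hg
    have h := SchwartzMap.one_add_le_sup_seminorm_apply (𝕜 := ℝ) (m := (K, 0)) (k := K) (n := 0)
      le_rfl le_rfl g ξ
    rw [norm_iteratedFDeriv_zero] at h
    have hsup : (Finset.Iic ((K, 0) : ℕ × ℕ)).sup
        (fun m => SchwartzMap.seminorm ℝ (E := EuclideanSpace ℝ ι) (F := ℂ) m.1 m.2) g ≤ D₀ :=
      Seminorm.finset_sup_apply_le hD₀0 fun m hm =>
        (hD m t l).trans (Finset.single_le_sum (fun j _ => hD0 j) hm)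
    have hpos : 0 < (1 + ‖ξ‖) ^ K := by positivity
    change ‖g ξ‖ ≤ A * ((1 + ‖ξ‖) ^ K)⁻¹
    rw [← div_eq_mul_inv, le_div_iff₀ hpos, mul_comm]
    exact h.trans (mul_le_mul_of_nonneg_left hsup (by positivity))
  refine HasDecay.of_apply (Finset.sum_nonneg fun _ _ => hA0) fun l => (hcomp l).mono ?_
  exact Finset.single_le_sum (fun _ _ => hA0) (Finset.mem_univ l)

end UniformDecay

/-! ## §4 Joint continuity of the Fourier-side force -/

section Continuity

variable {ι : Type*} [Fintype ι] [DecidableEq ι]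
variable {T : ℝ} {f : ℝ → EuclideanSpace ℝ ι → EuclideanSpace ℝ ι}
variable (hT : 0 < T) (hf : IsSmoothSpaceTimeOn (Icc 0 T) f) (hd : HasUniformRapidDecayOn (Icc 0 T) f)

omit [DecidableEq ι] in
include hT hf in
/-- Continuity of the clamped force `(t, x) ↦ f (clamp T t) x` on all of `ℝ × ℝ^ι`. [cite: Tao2011, Def. 1.1 (p. 3)] -/
theorem continuous_force_clamp_uncurry :
    Continuous fun p : ℝ × EuclideanSpace ℝ ι => f (clamp T p.1) p.2 := by
  have hc : ContinuousOn (uncurry f) (Icc 0 T ×ˢ univ) := hf.continuousOn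
  have hmap : Continuous fun p : ℝ × EuclideanSpace ℝ ι => ((clamp T p.1, p.2) : ℝ × EuclideanSpace ℝ ι) :=
    ((continuous_clamp T).comp continuous_fst).prodMk continuous_snd
  exact hc.comp_continuous hmap fun p => mk_mem_prod (clamp_mem_Icc hT.le p.1) (mem_univ _)

omit [DecidableEq ι] in
/-- **Joint continuity of the Fourier-side force, componentwise**: `(t, ξ) ↦ b t ξ l` is continuous
on `ℝ × ℝ^ι` (dominated convergence under the inverse Fourier integral, dominating function
`C (1 + ‖x‖)^{-(d+1)}` from the uniform decay of the slices). [cite: Tao2011, Thm. 5.4 proof (arXiv Thm. 31, p. 18)] -/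
theorem continuous_forceData_uncurry_apply (l : ι) :
    Continuous fun p : ℝ × EuclideanSpace ℝ ι => forceData hT hf hd p.1 p.2 l := by
  have hfun : (fun p : ℝ × EuclideanSpace ℝ ι => forceData hT hf hd p.1 p.2 l) =
      fun p => ∫ v, 𝐞 ⟪v, p.2⟫ • ((f (clamp T p.1) v l : ℝ) : ℂ) := by
    funext p
    rw [forceData_apply, Real.fourierInv_eq]
  rw [hfun]
  -- the dominating function
  set K : ℕ := Module.finrank ℝ (EuclideanSpace ℝ ι) + 1 with hK
  have hKr : (Module.finrank ℝ (EuclideanSpace ℝ ι) : ℝ) < (K : ℝ) := by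
    rw [hK]; push_cast; linarith
  obtain ⟨C, hC0, hC⟩ := hd.exists_uniform_slice_bound hf hT 0 K
  have hbound : ∀ (t : ℝ) (v : EuclideanSpace ℝ ι),
      ‖((f (clamp T t) v l : ℝ) : ℂ)‖ ≤ C * (1 + ‖v‖) ^ (-(K : ℝ)) := by
    intro t v
    have h1 := hC _ (clamp_mem_Icc hT.le t) v
    rw [norm_iteratedFDeriv_zero] at h1
    have h2 : ‖f (clamp T t) v l‖ ≤ ‖f (clamp T t) v‖ := PiLp.norm_apply_le _ l
    rw [Complex.norm_real]
    exact le_mul_rpow_neg_of_pow_mul_le ((mul_le_mul_of_nonneg_left h2 (by positivity)).trans h1)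
  have hcont := continuous_force_clamp_uncurry hT hf
  refine continuous_of_dominated (μ := volume)
    (F := fun (p : ℝ × EuclideanSpace ℝ ι) (v : EuclideanSpace ℝ ι) =>
      𝐞 ⟪v, p.2⟫ • ((f (clamp T p.1) v l : ℝ) : ℂ))
    (bound := fun v => C * (1 + ‖v‖) ^ (-(K : ℝ))) ?_ ?_ ?_ ?_
  · intro p
    refine Continuous.aestronglyMeasurable ?_
    have h1 : Continuous fun v : EuclideanSpace ℝ ι => ((f (clamp T p.1) v l : ℝ) : ℂ) :=
      Complex.continuous_ofReal.comp ((continuous_apply l).comp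
        ((PiLp.continuous_ofLp 2 _).comp (hcont.comp (Continuous.prodMk_right p.1))))
    exact (continuous_fourierChar.comp (continuous_id.inner continuous_const)).smul h1
  · intro p
    exact ae_of_all _ fun v => by rw [Circle.norm_smul]; exact hbound p.1 v
  · exact (integrable_one_add_norm hKr).const_mul C
  · refine ae_of_all _ fun v => ?_
    have h1 : Continuous fun p : ℝ × EuclideanSpace ℝ ι => ((f (clamp T p.1) v l : ℝ) : ℂ) :=
      Complex.continuous_ofReal.comp ((continuous_apply l).comp
        ((PiLp.continuous_ofLp 2 _).comp (hcont.comp (continuous_fst.prodMk continuous_const))))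
    exact (continuous_fourierChar.comp (continuous_const.inner continuous_snd)).smul h1

omit [DecidableEq ι] in
/-- **Joint continuity of the Fourier-side force**: `(t, ξ) ↦ b t ξ` is continuous on `ℝ × ℝ^ι`.
[cite: Tao2011, Thm. 5.4 proof (arXiv Thm. 31, p. 18)] -/
theorem continuous_forceData_uncurry :
    Continuous fun p : ℝ × EuclideanSpace ℝ ι => forceData hT hf hd p.1 p.2 :=
  continuous_pi fun l => continuous_forceData_uncurry_apply hT hf hd l

omit [DecidableEq ι] in
/-- **Continuity in time at fixed frequency**: `t ↦ b t ξ l` is continuous on `ℝ` (the input shape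
of the forced Picard hypotheses). [cite: Tao2011, Thm. 5.4 proof (arXiv Thm. 31, p. 18)] -/
theorem continuous_forceData_time_apply (ξ : EuclideanSpace ℝ ι) (l : ι) :
    Continuous fun t : ℝ => forceData hT hf hd t ξ l := by
  have hg : Continuous fun t : ℝ => ((t, ξ) : ℝ × EuclideanSpace ℝ ι) :=
    continuous_id.prodMk continuous_const
  exact Continuous.comp (f := fun t : ℝ => ((t, ξ) : ℝ × EuclideanSpace ℝ ι))
    (g := fun p : ℝ × EuclideanSpace ℝ ι => forceData hT hf hd p.1 p.2 l)
    (continuous_forceData_uncurry_apply hT hf hd l) hg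

omit [DecidableEq ι] in
/-- Continuity in time at fixed frequency of the vector `t ↦ b t ξ`. [cite: Tao2011, Thm. 5.4 proof (arXiv Thm. 31, p. 18)] -/
theorem continuous_forceData_time (ξ : EuclideanSpace ℝ ι) :
    Continuous fun t : ℝ => forceData hT hf hd t ξ :=
  continuous_pi fun l => continuous_forceData_time_apply hT hf hd ξ l

end Continuity

end FourierNS

end Literature.Analysis.FluidPDE

end
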